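import Literature.Probability.LatticeModels.PlanarIsingWuDiagonal
import HarnessLib

/-!
# The critical planar Ising two-point function decays like `|x|^{-1/4}` in every direction

Topic `Literature/Probability/LatticeModels`. The classical two-sided a priori bound

  `c · ‖x‖_∞^{-1/4} ≤ ⟨σ_0 σ_x⟩⁺_{ℤ², β_c} ≤ C · ‖x‖_∞^{-1/4}`,  `x ≠ 0`,

assembled, as is folklore (e.g. the a priori estimates of Chelkak–Hongler–Izyurov 2015, Remark
1.2 (iii) and §2.9, or of Camia–Garban–Newman 2015, §2), from two theorems already in the tree:

* **Wu's exact diagonal correlations** `⟨σ_{(0,0)}σ_{(n,n)}⟩⁺_{β_c} = wuDiag n` with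
  `n^{1/4} wuDiag n → A_Wu > 0` (T. T. Wu 1966; McCoy–Wu 1973, Ch. XI;
  `twoPointPlus_criticalBetaTwo_diag_eq_wuDiag`, `exists_tendsto_rpow_mul_wuDiag` of
  `PlanarIsingWuDiagonal.lean` / `PlanarIsingWuDiag.lean`), and
* the **Messager–Miracle-Solé monotonicity** of the plus-state two-point function under axis and
  diagonal reflections (Messager–Miracle-Solé 1977; Hegerfeldt 1977; `messager_miracleSole_holds`,
  `messager_miracleSole_diag_holds` of `MessagerMiracleSole.lean`), together with the lattice
  symmetries (`twoPointPlus_reflection_invariant_holds`, `twoPointPlus_perm_invariant_holds`).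

Contents (everything proved; no named fact):

* `exists_wuDiag_le_rpow`, `exists_rpow_le_wuDiag` — `c n^{-1/4} ≤ wuDiag n ≤ C n^{-1/4}` for
  `n ≥ 1` (a convergent positive sequence is bounded above and below);
* the Messager–Miracle-Solé chains on `ℤ²` (`twoPointPlus_snd_succ_le`, `twoPointPlus_fst_succ_le`,
  `twoPointPlus_diag_le_of_le`, `twoPointPlus_antiDiag_shift_le`): for `0 ≤ b ≤ a`,
  `⟨σ_0σ_{(a,a)}⟩ ≤ ⟨σ_0σ_{(a,b)}⟩ ≤ ⟨σ_0σ_{(m,m)}⟩`, `m = ⌊(a+b)/2⌋`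
  (**`wuDiag_le_twoPointPlus`**, **`twoPointPlus_le_wuDiag`**);
* the reduction of a general site to `0 ≤ b ≤ a` by reflections and the swap
  (`twoPointPlus_eq_abs`, `twoPointPlus_swap`, `twoPointPlus_eq_max_min`);
* **`exists_twoPointPlus_criticalBetaTwo_le_rpow`**, **`exists_rpow_le_twoPointPlus_criticalBetaTwo`**:
  the two-sided bound above with the sup norm `max |x 0| |x 1|`.

This is the full-plane input of the boundary estimates of the spinor-observable programme behind
`chi_onePoint_rho` / `chi_twoPoint_free_jordan` (the squared Kadanoff–Ceva corner values at
boundary plaquettes are dual free two-point functions from the bulk to the boundary, bounded by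
`⟨σ_0σ_x⟩⁺_{ℤ²,β_c}` through Griffiths' inequalities, hence `O((δ/dist)^{1/4})`).

## References

* T. T. Wu, Phys. Rev. 149 (1966) 380; B. M. McCoy, T. T. Wu, *The two-dimensional Ising model*
  (1973), Ch. XI — `Wu1966`, `MccoyWu1973`.
* A. Messager, S. Miracle-Solé, J. Stat. Phys. 17 (1977) 245–262 — `MessagerMiracleSoleJSP1977`.
* D. Chelkak, C. Hongler, K. Izyurov, Ann. of Math. 181 (2015), Remark 1.2 (iii) —
  `ChelkakHonglerIzyurovAnnals2015`.
-/

noncomputable section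

namespace Literature.Probability.LatticeModels

open Filter Topology Real

/-! ### Wu's diagonal values are of order `n^{-1/4}` -/

/-- **Upper bound**: `wuDiag n ≤ C n^{-1/4}` for `n ≥ 1`, with `C > 0` (the convergent sequence
`n^{1/4} wuDiag n` is bounded). [cite: MccoyWu1973, Ch. XI (T = T_c asymptotics of the diagonal correlation)] -/
theorem exists_wuDiag_le_rpow :
    ∃ C : ℝ, 0 < C ∧ ∀ n : ℕ, 1 ≤ n → wuDiag n ≤ C * (n : ℝ) ^ (-(1 / 4 : ℝ)) := by
  obtain ⟨A, hA, hT⟩ := exists_tendsto_rpow_mul_wuDiag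
  obtain ⟨B, hB⟩ := hT.bddAbove_range
  have hB1 : (1 : ℝ) ^ ((1 : ℝ) / 4) * wuDiag 1 ≤ B := hB ⟨1, by simp⟩
  have hBpos : 0 < B := by
    rw [Real.one_rpow, one_mul] at hB1
    exact (wuDiag_pos 1).trans_le hB1
  refine ⟨B, hBpos, fun n hn => ?_⟩
  have hn0 : (0 : ℝ) < n := by exact_mod_cast hn
  have hle : (n : ℝ) ^ ((1 : ℝ) / 4) * wuDiag n ≤ B := hB ⟨n, rfl⟩
  have hp : 0 < (n : ℝ) ^ ((1 : ℝ) / 4) := Real.rpow_pos_of_pos hn0 _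
  rw [Real.rpow_neg hn0.le, ← div_eq_mul_inv, le_div_iff₀ hp]
  linarith [mul_comm (wuDiag n) ((n : ℝ) ^ ((1 : ℝ) / 4))]

/-- **Lower bound**: `c n^{-1/4} ≤ wuDiag n` for `n ≥ 1`, with `c > 0` (the sequence
`n^{1/4} wuDiag n` has a positive limit and positive terms). [cite: MccoyWu1973, Ch. XI (T = T_c asymptotics of the diagonal correlation)] -/
theorem exists_rpow_le_wuDiag :
    ∃ c : ℝ, 0 < c ∧ ∀ n : ℕ, 1 ≤ n → c * (n : ℝ) ^ (-(1 / 4 : ℝ)) ≤ wuDiag n := by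
  obtain ⟨A, hA, hT⟩ := exists_tendsto_rpow_mul_wuDiag
  set f : ℕ → ℝ := fun N => (N : ℝ) ^ ((1 : ℝ) / 4) * wuDiag N with hf
  have hev : ∀ᶠ N in atTop, A / 2 < f N := hT.eventually (Ioi_mem_nhds (by linarith))
  obtain ⟨N₀, hN₀⟩ := eventually_atTop.1 hev
  have hfpos : ∀ N : ℕ, 1 ≤ N → 0 < f N := fun N hN =>
    mul_pos (Real.rpow_pos_of_pos (by exact_mod_cast hN) _) (wuDiag_pos N)
  -- the minimum over the initial segment `1 ≤ N ≤ N₀`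
  set S : Finset ℝ := (Finset.Icc 1 (max N₀ 1)).image f with hS
  have hSne : S.Nonempty := ⟨f 1, Finset.mem_image.2 ⟨1, Finset.mem_Icc.2 ⟨le_rfl, le_max_right _ _⟩, rfl⟩⟩
  set m := S.min' hSne with hm
  have hmpos : 0 < m := by
    have hmem := S.min'_mem hSne
    rw [← hm] at hmem
    obtain ⟨N, hN, hNm⟩ := Finset.mem_image.1 hmem
    rw [← hNm]
    exact hfpos N (Finset.mem_Icc.1 hN).1
  refine ⟨min (A / 2) m, lt_min (by linarith) hmpos, fun n hn => ?_⟩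
  have hn0 : (0 : ℝ) < n := by exact_mod_cast hn
  have hp : 0 < (n : ℝ) ^ ((1 : ℝ) / 4) := Real.rpow_pos_of_pos hn0 _
  have hfn : min (A / 2) m ≤ f n := by
    by_cases h : n ≤ max N₀ 1
    · have : f n ∈ S := Finset.mem_image.2 ⟨n, Finset.mem_Icc.2 ⟨hn, h⟩, rfl⟩
      exact (min_le_right _ _).trans (S.min'_le _ this)
    · push Not at h
      exact (min_le_left _ _).trans (hN₀ n ((le_max_left _ _).trans h.le)).le
  rw [Real.rpow_neg hn0.le, ← div_eq_mul_inv, div_le_iff₀ hp]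
  simpa [hf, mul_comm] using hfn

/-! ### The Messager–Miracle-Solé chains on `ℤ²` -/

/-- One step away from the axis in the second coordinate does not increase the correlation:
`⟨σ_0σ_{(a,b+1)}⟩ ≤ ⟨σ_0σ_{(a,b)}⟩` for `b ≥ 0`. [cite: MessagerMiracleSoleJSP1977, main theorem (monotonicity of ⟨σ₀σ_x⟩ under reflections)] -/
theorem twoPointPlus_snd_succ_le {β : ℝ} (hβ : 0 ≤ β) (a : ℤ) {b : ℤ} (hb : 0 ≤ b) :
    twoPointPlus 2 β ![a, b + 1] ≤ twoPointPlus 2 β ![a, b] := by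
  have h := messager_miracleSole_holds (d := 2) (β := β) hβ ![a, b] 1 (by simpa using hb)
  have he : (![a, b] : Site 2) + Pi.single 1 1 = ![a, b + 1] := by
    funext i; fin_cases i <;> simp
  rwa [he] at h

/-- One step away from the axis in the first coordinate does not increase the correlation:
`⟨σ_0σ_{(a+1,b)}⟩ ≤ ⟨σ_0σ_{(a,b)}⟩` for `a ≥ 0`. [cite: MessagerMiracleSoleJSP1977, main theorem (monotonicity of ⟨σ₀σ_x⟩ under reflections)] -/
theorem twoPointPlus_fst_succ_le {β : ℝ} (hβ : 0 ≤ β) {a : ℤ} (ha : 0 ≤ a) (b : ℤ) :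
    twoPointPlus 2 β ![a + 1, b] ≤ twoPointPlus 2 β ![a, b] := by
  have h := messager_miracleSole_holds (d := 2) (β := β) hβ ![a, b] 0 (by simpa using ha)
  have he : (![a, b] : Site 2) + Pi.single 0 1 = ![a + 1, b] := by
    funext i; fin_cases i <;> simp
  rwa [he] at h

/-- **Lower chain**: `⟨σ_0σ_{(a,a)}⟩ ≤ ⟨σ_0σ_{(a,a-n)}⟩` for `n ≤ a` (iterate the axis step from
`(a, a-n)` up to the diagonal). [cite: MessagerMiracleSoleJSP1977, main theorem (monotonicity of ⟨σ₀σ_x⟩ under reflections)] -/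
theorem twoPointPlus_diag_le_of_le {β : ℝ} (hβ : 0 ≤ β) (a : ℤ) :
    ∀ n : ℕ, (n : ℤ) ≤ a → twoPointPlus 2 β ![a, a] ≤ twoPointPlus 2 β ![a, a - n]
  | 0, _ => by simp
  | n + 1, hn => by
    have ih := twoPointPlus_diag_le_of_le hβ a n (by push_cast at hn; omega)
    have hstep := twoPointPlus_snd_succ_le hβ a (b := a - (n + 1 : ℕ)) (by push_cast at hn ⊢; omega)
    have he : (a - ((n + 1 : ℕ) : ℤ) + 1 : ℤ) = a - n := by push_cast; ring
    rw [he] at hstep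
    exact ih.trans hstep

/-- **Upper chain**: `⟨σ_0σ_{(m+k,m-k)}⟩ ≤ ⟨σ_0σ_{(m,m)}⟩` (iterate the diagonal-reflection step
along the anti-diagonal through `(m, m)`). [cite: MessagerMiracleSoleJSP1977, main theorem (monotonicity of ⟨σ₀σ_x⟩ under reflections)] -/
theorem twoPointPlus_antiDiag_shift_le {β : ℝ} (hβ : 0 ≤ β) (m : ℤ) :
    ∀ k : ℕ, twoPointPlus 2 β ![m + k, m - k] ≤ twoPointPlus 2 β ![m, m]
  | 0 => by simp
  | k + 1 => by
    have ih := twoPointPlus_antiDiag_shift_le hβ m k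
    have h := messager_miracleSole_diag_holds (d := 2) (β := β) hβ ![m + k, m - k] (i := 0) (j := 1) (by decide)
      (by simp; omega)
    have he : (![m + k, m - k] : Site 2) + Pi.single 0 1 - Pi.single 1 1 = ![m + (k + 1 : ℕ), m - (k + 1 : ℕ)] := by
      funext i; fin_cases i
      · show (m + k) + (Pi.single (0 : Fin 2) (1 : ℤ) : Site 2) 0 - (Pi.single (1 : Fin 2) (1 : ℤ) : Site 2) 0 = m + ((k + 1 : ℕ) : ℤ)
        simp; ring
      · show (m - k) + (Pi.single (0 : Fin 2) (1 : ℤ) : Site 2) 1 - (Pi.single (1 : Fin 2) (1 : ℤ) : Site 2) 1 = m - ((k + 1 : ℕ) : ℤ)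
        simp; ring
    rw [he] at h
    exact h.trans ih

/-- **`wuDiag a ≤ ⟨σ_0σ_{(a,b)}⟩⁺_{β_c}` for `0 ≤ b ≤ a`, `1 ≤ a`.** [cite: MessagerMiracleSoleJSP1977, main theorem; MccoyWu1973, Ch. XI] -/
theorem wuDiag_le_twoPointPlus {a b : ℕ} (hba : b ≤ a) (ha : 1 ≤ a) :
    wuDiag a ≤ twoPointPlus 2 criticalBetaTwo ![(a : ℤ), (b : ℤ)] := by
  rw [← twoPointPlus_criticalBetaTwo_diag_eq_wuDiag ha]
  have h := twoPointPlus_diag_le_of_le criticalBetaTwo_pos.le (a : ℤ) (a - b) (by omega)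
  have he : ((a : ℤ) - ((a - b : ℕ) : ℤ)) = b := by push_cast [Nat.cast_sub hba]; ring
  rwa [he] at h

/-- **`⟨σ_0σ_{(a,b)}⟩⁺_{β_c} ≤ wuDiag ⌊(a+b)/2⌋` for `0 ≤ b ≤ a`** (for `a + b` odd, first one axis
step `(a,b) → (a-1,b)`; `wuDiag 0 = 1` covers `(a,b) = (1,0)`). [cite: MessagerMiracleSoleJSP1977, main theorem; MccoyWu1973, Ch. XI] -/
theorem twoPointPlus_le_wuDiag {a b : ℕ} (hba : b ≤ a) :
    twoPointPlus 2 criticalBetaTwo ![(a : ℤ), (b : ℤ)] ≤ wuDiag ((a + b) / 2) := by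
  have hβ := criticalBetaTwo_pos.le
  -- the even case, for any `a' ≥ b` with `a' + b` even
  have heven : ∀ a' : ℕ, b ≤ a' → Even (a' + b) →
      twoPointPlus 2 criticalBetaTwo ![(a' : ℤ), (b : ℤ)] ≤ wuDiag ((a' + b) / 2) := by
    intro a' hba' hev
    obtain ⟨m, hm⟩ := hev
    have hm2 : (a' + b) / 2 = m := by omega
    obtain ⟨k, hk⟩ : ∃ k : ℕ, a' = m + k ∧ b + k = m := ⟨a' - m, by omega, by omega⟩
    have h := twoPointPlus_antiDiag_shift_le hβ (m : ℤ) k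
    have he : (![(m : ℤ) + k, (m : ℤ) - k] : Site 2) = ![(a' : ℤ), (b : ℤ)] := by
      funext i; fin_cases i <;> simp <;> omega
    rw [he] at h
    rw [hm2]
    rcases Nat.eq_zero_or_pos m with hm0 | hmpos
    · -- `m = 0`: then `a' = b = 0` and both sides are `1`
      have ha0 : a' = 0 := by omega
      have hb0 : b = 0 := by omega
      subst ha0; subst hb0
      rw [hm0, wuDiag_zero]
      have : (![((0 : ℕ) : ℤ), ((0 : ℕ) : ℤ)] : Site 2) = 0 := by funext i; fin_cases i <;> simp
      rw [this, twoPointPlus_origin]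
    · rwa [twoPointPlus_criticalBetaTwo_diag_eq_wuDiag hmpos] at h
  rcases Nat.even_or_odd (a + b) with hev | hodd
  · exact heven a hba hev
  · -- odd: `a ≥ b + 1`, step to `(a - 1, b)`
    have ha1 : b + 1 ≤ a := by
      rcases hba.lt_or_eq with h | h
      · omega
      · exfalso; subst h; exact Nat.not_even_iff_odd.2 hodd ⟨b, rfl⟩
    have hstep := twoPointPlus_fst_succ_le hβ (a := ((a - 1 : ℕ) : ℤ)) (by positivity) (b : ℤ)
    have he : (((a - 1 : ℕ) : ℤ) + 1 : ℤ) = a := by push_cast [Nat.cast_sub (by omega : 1 ≤ a)]; ring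
    rw [he] at hstep
    have hev' : Even (a - 1 + b) := by
      obtain ⟨r, hr⟩ := hodd; exact ⟨r, by omega⟩
    have h2 := heven (a - 1) (by omega) hev'
    have hdiv : (a - 1 + b) / 2 = (a + b) / 2 := by obtain ⟨r, hr⟩ := hodd; omega
    rw [hdiv] at h2
    exact hstep.trans h2

/-! ### Reduction of a general site by the symmetries of `ℤ²` -/

/-- `⟨σ_0σ_x⟩ = ⟨σ_0σ_{(|x₀|,|x₁|)}⟩` (coordinate reflections). [cite: FriedliVelenik2017, Exercise 3.14] -/
theorem twoPointPlus_eq_abs {β : ℝ} (hβ : 0 ≤ β) (x : Site 2) :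
    twoPointPlus 2 β x = twoPointPlus 2 β ![|x 0|, |x 1|] := by
  -- reflect the first coordinate if negative
  have h0 : twoPointPlus 2 β x = twoPointPlus 2 β ![|x 0|, x 1] := by
    by_cases hx : 0 ≤ x 0
    · congr 1; funext i; fin_cases i <;> simp [abs_of_nonneg hx]
    · push Not at hx
      rw [← twoPointPlus_reflection_invariant_holds (d := 2) hβ 0 x]
      congr 1; funext i; fin_cases i <;> simp [abs_of_neg hx]
  rw [h0]
  by_cases hx : 0 ≤ x 1
  · congr 1; funext i; fin_cases i <;> simp [abs_of_nonneg hx]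
  · push Not at hx
    rw [← twoPointPlus_reflection_invariant_holds (d := 2) hβ 1 ![|x 0|, x 1]]
    congr 1; funext i; fin_cases i <;> simp [abs_of_neg hx]

/-- `⟨σ_0σ_{(u,v)}⟩ = ⟨σ_0σ_{(v,u)}⟩` (the swap of coordinates). [cite: FriedliVelenik2017, Exercise 3.14] -/
theorem twoPointPlus_swap {β : ℝ} (hβ : 0 ≤ β) (u v : ℤ) :
    twoPointPlus 2 β ![u, v] = twoPointPlus 2 β ![v, u] := by
  rw [← twoPointPlus_perm_invariant_holds (d := 2) hβ (Equiv.swap 0 1) ![v, u]]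
  congr 1; funext i; fin_cases i <;> simp

/-- `⟨σ_0σ_x⟩ = ⟨σ_0σ_{(a,b)}⟩` with `a = max |x₀| |x₁|`, `b = min |x₀| |x₁|`. [cite: FriedliVelenik2017, Exercise 3.14] -/
theorem twoPointPlus_eq_max_min {β : ℝ} (hβ : 0 ≤ β) (x : Site 2) :
    twoPointPlus 2 β x = twoPointPlus 2 β ![max |x 0| |x 1|, min |x 0| |x 1|] := by
  rw [twoPointPlus_eq_abs hβ x]
  rcases le_total |x 1| |x 0| with h | h
  · rw [max_eq_left h, min_eq_right h]
  · rw [max_eq_right h, min_eq_left h, twoPointPlus_swap hβ]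

/-! ### The two-sided power-law bound -/

/-- A fourth-root comparison: `m^{-1/4} ≤ 2 a^{-1/4}` when `0 < a ≤ 16 m`. [folklore] -/
theorem rpow_neg_quarter_le_two_mul {m a : ℝ} (hm : 0 < m) (ha : 0 < a) (h : a ≤ 16 * m) :
    m ^ (-(1 / 4 : ℝ)) ≤ 2 * a ^ (-(1 / 4 : ℝ)) := by
  have h16 : (16 : ℝ) ^ ((1 : ℝ) / 4) = 2 := by
    rw [show (16 : ℝ) = 2 ^ (4 : ℝ) by norm_num, ← Real.rpow_mul (by norm_num)]
    norm_num
  rw [Real.rpow_neg hm.le, Real.rpow_neg ha.le, ← Real.inv_rpow hm.le, ← Real.inv_rpow ha.le, ← h16,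
    ← Real.mul_rpow (by norm_num) (inv_nonneg.2 ha.le)]
  refine Real.rpow_le_rpow (inv_nonneg.2 hm.le) ?_ (by norm_num)
  calc m⁻¹ = a⁻¹ * (a / m) := by field_simp
    _ ≤ a⁻¹ * 16 := by gcongr; rwa [div_le_iff₀ hm]
    _ = 16 * a⁻¹ := by ring

/-- **The critical two-point function of `ℤ²` is `O(‖x‖_∞^{-1/4})`**: there is `C > 0` with
`⟨σ_0σ_x⟩⁺_{β_c} ≤ C · (max |x₀| |x₁|)^{-1/4}` for every `x ≠ 0` (Wu's diagonal asymptotics moved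
to all directions by the Messager–Miracle-Solé inequalities). [cite: MccoyWu1973, Ch. XI; MessagerMiracleSoleJSP1977, main theorem] -/
theorem exists_twoPointPlus_criticalBetaTwo_le_rpow :
    ∃ C : ℝ, 0 < C ∧ ∀ x : Site 2, x ≠ 0 →
      twoPointPlus 2 criticalBetaTwo x ≤ C * ((max |x 0| |x 1| : ℤ) : ℝ) ^ (-(1 / 4 : ℝ)) := by
  obtain ⟨C, hC, hCle⟩ := exists_wuDiag_le_rpow
  have hβ := criticalBetaTwo_pos.le
  refine ⟨max 1 (2 * C), lt_max_of_lt_left one_pos, fun x hx => ?_⟩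
  -- reduce to `0 ≤ b ≤ a`, `1 ≤ a`
  set a : ℕ := (max |x 0| |x 1|).toNat with hadef
  set b : ℕ := (min |x 0| |x 1|).toNat with hbdef
  have hmax0 : 0 ≤ max |x 0| |x 1| := le_max_of_le_left (abs_nonneg _)
  have hmin0 : 0 ≤ min |x 0| |x 1| := le_min (abs_nonneg _) (abs_nonneg _)
  have haz : (a : ℤ) = max |x 0| |x 1| := Int.toNat_of_nonneg hmax0
  have hbz : (b : ℤ) = min |x 0| |x 1| := Int.toNat_of_nonneg hmin0
  have hba : b ≤ a := by
    have : (b : ℤ) ≤ a := by rw [haz, hbz]; exact min_le_max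
    exact_mod_cast this
  have ha1 : 1 ≤ a := by
    by_contra h
    push Not at h
    have ha0 : a = 0 := by omega
    have hm : max |x 0| |x 1| = 0 := by rw [← haz, ha0]; rfl
    apply hx
    funext i
    have h0 : |x 0| ≤ 0 := (le_max_left _ _).trans hm.le
    have h1 : |x 1| ≤ 0 := (le_max_right _ _).trans hm.le
    fin_cases i
    · exact abs_nonpos_iff.1 h0
    · exact abs_nonpos_iff.1 h1
  have hred : twoPointPlus 2 criticalBetaTwo x = twoPointPlus 2 criticalBetaTwo ![(a : ℤ), (b : ℤ)] := by
    rw [twoPointPlus_eq_max_min hβ x, haz, hbz]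
  rw [hred, ← haz]
  have hup := twoPointPlus_le_wuDiag hba
  have ha0 : (0 : ℝ) < a := by exact_mod_cast ha1
  have hapow : 0 < (a : ℝ) ^ (-(1 / 4 : ℝ)) := Real.rpow_pos_of_pos ha0 _
  by_cases ha2 : a = 1
  · -- `‖x‖_∞ = 1`: the correlation is at most `1`
    have h1 : twoPointPlus 2 criticalBetaTwo ![(a : ℤ), (b : ℤ)] ≤ 1 := twoPointPlus_le_one_of_nonneg hβ _
    rw [ha2]; push_cast; rw [Real.one_rpow, mul_one]
    exact (ha2 ▸ h1).trans (le_max_left _ _)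
  · -- `a ≥ 2`: `m = ⌊(a+b)/2⌋ ≥ 1` and `a ≤ 4m`
    set m : ℕ := (a + b) / 2 with hmdef
    have hm1 : 1 ≤ m := by omega
    have hm0 : (0 : ℝ) < m := by exact_mod_cast hm1
    have h16 : (a : ℝ) ≤ 16 * m := by
      have : a ≤ 16 * m := by omega
      exact_mod_cast this
    calc twoPointPlus 2 criticalBetaTwo ![(a : ℤ), (b : ℤ)] ≤ wuDiag m := hup
      _ ≤ C * (m : ℝ) ^ (-(1 / 4 : ℝ)) := hCle m hm1
      _ ≤ C * (2 * (a : ℝ) ^ (-(1 / 4 : ℝ))) := by gcongr; exact rpow_neg_quarter_le_two_mul hm0 ha0 h16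
      _ = (2 * C) * ((a : ℤ) : ℝ) ^ (-(1 / 4 : ℝ)) := by push_cast; ring
      _ ≤ max 1 (2 * C) * ((a : ℤ) : ℝ) ^ (-(1 / 4 : ℝ)) := by
          gcongr
          exact le_max_right _ _

/-- **The critical two-point function of `ℤ²` is bounded below by `c ‖x‖_∞^{-1/4}`**: there is
`c > 0` with `c · (max |x₀| |x₁|)^{-1/4} ≤ ⟨σ_0σ_x⟩⁺_{β_c}` for every `x ≠ 0`. [cite: MccoyWu1973, Ch. XI; MessagerMiracleSoleJSP1977, main theorem] -/
theorem exists_rpow_le_twoPointPlus_criticalBetaTwo :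
    ∃ c : ℝ, 0 < c ∧ ∀ x : Site 2, x ≠ 0 →
      c * ((max |x 0| |x 1| : ℤ) : ℝ) ^ (-(1 / 4 : ℝ)) ≤ twoPointPlus 2 criticalBetaTwo x := by
  obtain ⟨c, hc, hcle⟩ := exists_rpow_le_wuDiag
  have hβ := criticalBetaTwo_pos.le
  refine ⟨c, hc, fun x hx => ?_⟩
  set a : ℕ := (max |x 0| |x 1|).toNat with hadef
  set b : ℕ := (min |x 0| |x 1|).toNat with hbdef
  have hmax0 : 0 ≤ max |x 0| |x 1| := le_max_of_le_left (abs_nonneg _)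
  have hmin0 : 0 ≤ min |x 0| |x 1| := le_min (abs_nonneg _) (abs_nonneg _)
  have haz : (a : ℤ) = max |x 0| |x 1| := Int.toNat_of_nonneg hmax0
  have hbz : (b : ℤ) = min |x 0| |x 1| := Int.toNat_of_nonneg hmin0
  have hba : b ≤ a := by
    have : (b : ℤ) ≤ a := by rw [haz, hbz]; exact min_le_max
    exact_mod_cast this
  have ha1 : 1 ≤ a := by
    by_contra h
    push Not at h
    have ha0 : a = 0 := by omega
    have hm : max |x 0| |x 1| = 0 := by rw [← haz, ha0]; rfl
    apply hx
    funext i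
    have h0 : |x 0| ≤ 0 := (le_max_left _ _).trans hm.le
    have h1 : |x 1| ≤ 0 := (le_max_right _ _).trans hm.le
    fin_cases i
    · exact abs_nonpos_iff.1 h0
    · exact abs_nonpos_iff.1 h1
  have hred : twoPointPlus 2 criticalBetaTwo x = twoPointPlus 2 criticalBetaTwo ![(a : ℤ), (b : ℤ)] := by
    rw [twoPointPlus_eq_max_min hβ x, haz, hbz]
  rw [hred, ← haz]
  push_cast
  exact (hcle a ha1).trans (wuDiag_le_twoPointPlus hba ha1)

end Literature.Probability.LatticeModels
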